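import Summits.AtomisticToContinuum.Crystallization.Theorems.ExcessDecayLiouvilleStepDecay

/-!
# Route `ExcessDecayLiouville`: the decay step with a satisfiable self-force threshold (nonlinear half, XVI′)

Harmonic-replacement architecture for item `ExcessDecay` (stmt-AtomisticToContinuum-9334), nonlinear half.
The hypothesis `hs₃` of `step_decay_relax` / `step_decay` reads `Cˢ·(κ/(2·10¹⁰)) + Cᴮ·‖Bᵀ‖ ≤ κ²/10¹¹`; since
`Cˢ ≈ 4.57·10⁶` this forces `κ ≥ 2.3·10⁷`, incompatible with `κ ≤ 1`, so those statements (and `induction_step`,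
`induction_step₂` downstream) can never be instantiated.  The self-force of `aff + T` is really bounded by
`Cˢ·‖aᵀ0 − aᵀ1‖ + Cᴮ‖Bᵀ‖` with the ACTUAL optical jump `‖aᵀ0 − aᵀ1‖`, which `taylor_jump_le` bounds by the
scale-small expression of `hs₂`; this file restates the two theorems with `hs₃` on that expression
(`step_decay_relax'`, `step_decay'`), proofs otherwise verbatim.
All `[folklore]`; helper lemmas, nothing here closes an item.
-/

noncomputable section

noncomputable section

namespace Summit.AtomisticToContinuum.Crystallization.Theorems.ExcessDecayLiouville

open scoped BigOperators Topology InnerProductSpace RealInnerProductSpace Classical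
open Literature.MathematicalPhysics.StatisticalMechanics
open Summit.AtomisticToContinuum.Crystallization.Theorems.PhononStabilityNegative

local notation "E3" => EuclideanSpace ℝ (Fin 3)

-- Local notation: the force-constant map `K(e)w = h(|e|²)w + 2⟪e,w⟫h′(|e|²)e` (`= forceConst e w`).
local notation3 "𝕂[" e "] " w:max =>
  (-((‖e‖ ^ 2)⁻¹) ^ 7 + ((‖e‖ ^ 2)⁻¹) ^ 4) • w + (2 * ⟪e, w⟫ * (7 * ((‖e‖ ^ 2)⁻¹) ^ 8 - 4 * ((‖e‖ ^ 2)⁻¹) ^ 5)) • e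
-- Local notation: the pair force `F(x) = h(|x|²) x`.
local notation3 "𝐅[" x "]" => ((-((‖x‖ ^ 2)⁻¹) ^ 7 + ((‖x‖ ^ 2)⁻¹) ^ 4) • x)
set_option quotPrecheck false in
-- Local notation: ball indicator.
local notation "𝟙ᵇ[" x ", " c ", " R "]" => (if dist (x : EuclideanSpace ℝ (Fin 3)) c ≤ R then (1 : ℝ) else 0)
-- Local notation: lattice basis.
local notation "𝐮₁" => (triangularVec₁ 1 : EuclideanSpace ℝ (Fin 3))
local notation "𝐮₂" => (triangularVec₂ 1 : EuclideanSpace ℝ (Fin 3))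
local notation "𝐰₃" => (layerNormal (2 * Real.sqrt (2 / 3)) : EuclideanSpace ℝ (Fin 3))
-- the constants of one level in mass form
local notation "Cₐ" => (19 * (1024 / ((23 / 25 : ℝ) ^ 3 * (23 / 25 : ℝ) ^ 3)) + 38 * (1024 / (23 / 25 : ℝ) ^ 3))
local notation "Cⱼ" => (9961472 : ℝ)

section

variable {t : Fin 2 → E3} {A : E3 →L[ℝ] E3} {c₀ : E3} {κ : ℝ}

set_option quotPrecheck false in
-- Local notation: the operator row `(L v)(p)`.
local notation "𝕃" v:max " @ " p:max =>
  tsum (fun q : Sites₀ t A => (if ((p : Sites₀ t A) : E3) ≠ q then 𝕂[((p : Sites₀ t A) : E3) - q] (v ((p : Sites₀ t A) : E3) - v q) else 0))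
set_option quotPrecheck false in
-- local mass on the ball of radius `X` about `c₀`
local notation "𝐌[" f ", " X "]" =>
  tsum (fun p : Sites₀ t A => ‖f (p : EuclideanSpace ℝ (Fin 3))‖ ^ 2 * 𝟙ᵇ[p, c₀, X])
set_option quotPrecheck false in
-- weighted far mass with floor `Y` about `c₀`
local notation "𝐉[" f ", " Y "]" =>
  tsum (fun q : Sites₀ t A => ‖f (q : EuclideanSpace ℝ (Fin 3))‖ ^ 2 * (max (dist (q : EuclideanSpace ℝ (Fin 3)) c₀) Y)⁻¹ ^ 8)
set_option quotPrecheck false in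
-- lattice difference
local notation "Δ[" τ "] " f:max => (fun x : EuclideanSpace ℝ (Fin 3) => f (x + A τ) - f x)
set_option quotPrecheck false in
-- the level constant `L = (4Cₐ + 24Cⱼ)/κ + 1`
local notation "𝐋" => ((4 * Cₐ + 24 * Cⱼ) / κ + 1)
set_option quotPrecheck false in
-- the gradient far mass
local notation "𝐉Δ[" h ", " Y "]" => (𝐉[Δ[𝐮₁] h, Y] + 𝐉[Δ[𝐮₂] h, Y] + 𝐉[Δ[𝐰₃] h, Y])
set_option quotPrecheck false in
-- Local notation: the displaced self-force `G(p)` of the background `aff`.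
local notation "𝐆[" aff "] " p:max =>
  tsum (fun q : Sites₀ t A => (if (p : E3) ≠ q then 𝐅[((p : E3) - q) + (aff (p : E3) - aff q)] else 0))
set_option quotPrecheck false in
-- Local notation: the natural force `Ψ_B(s)` at `t 0`.
local notation "𝚿[" B ", " s "]" =>
  tsum (fun q : Sites₀ t A => (if (t 0 : E3) ≠ q then
    𝐅[((t 0 : E3) - q) + (B ((t 0 : E3) - q) + (if (∃ z ∈ Λ₀, (q : E3) = t 1 + A z) then s else 0))] else 0))
-- the two Lipschitz constants of the natural force
local notation "Cˢ" => (38 * (25 / 23) * (1024 / ((23 / 25 : ℝ) ^ 3 * (23 / 25 : ℝ) ^ 4)) +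
  (1024 / ((23 / 25 : ℝ) ^ 3 * (23 / 25 : ℝ) ^ 4)) * ((25 / 23 : ℝ) ^ 2 * (72 + 2000)))
local notation "Cᴮ" => (5660 * (1024 / ((23 / 25 : ℝ) ^ 3 * (23 / 25 : ℝ) ^ 3)))

/-- **Relaxation part of the decay step, corrected self-force threshold** (`step_decay_relax` with its
hypothesis `hs₃` stated for the ACTUAL optical jump bound of `taylor_jump_le` instead of the jump threshold
`κ/(2·10¹⁰)`; the original `hs₃` is unsatisfiable for `κ ≤ 1` since `Cˢ ≈ 4.57·10⁶`).  The optical jump of the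
Taylor data and the relaxation of `aff + T` (`exists_relaxed_field`). [folklore] -/
theorem step_decay_relax' (hA : Adm₀ A) (hI : Inner₀ t A) (hκ0 : 0 < κ) (hκ1 : κ ≤ 1)
    (hκ : ∀ v : E3 → E3, (Function.support v).Finite → Function.support v ⊆ Sites₀ t A →
      κ * nnForm t A v ≤ ∑' p : Sites₀ t A, ⟪𝕃 v @ p, v p⟫)
    {h : E3 → E3} (hh : (Function.support h).Finite) {ρ : ℝ} (hρ : 64 ≤ ρ)
    {z₀ : E3} (hz₀ : z₀ ∈ Λ₀) (hp₀c : dist (t 0 + A z₀) c₀ ≤ 11 / 10)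
    (hrow0 : 𝕃 h @ (⟨t 0 + A z₀, add_mem_sites₀ t0_mem_sites hz₀⟩ : Sites₀ t A) = 0)
    {J : ℝ} (hJ : 𝐉[h, ρ] ≤ J)
    {aff : E3 → E3} {a : Fin 2 → E3} {Bm : E3 →L[ℝ] E3}
    (haff : ∀ (m : Fin 2) (z : E3), z ∈ Λ₀ → aff (t m + A z) = a m + Bm (t m + A z - c₀))
    (hrel : ∀ p : Sites₀ t A, 𝐆[aff] p = 0)
    (hBm : ‖Bm‖ ≤ κ / (2 * 10 ^ 10)) (ha : ‖a 0 - a 1‖ ≤ κ / (2 * 10 ^ 10))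
    (aT : Fin 2 → E3) (BT : E3 →L[ℝ] E3) (ha0 : aT 0 = h (t 0 + A z₀)) {K Vₐ : ℝ} (hK : 0 ≤ K)
    (hVa : ∀ m, ‖aT m‖ ≤ Vₐ)
    (hT : ∀ (m : Fin 2) (z : E3), z ∈ Λ₀ →
      (fun x : E3 => (if (∃ z ∈ Λ₀, x = t 1 + A z) then aT 1 else aT 0) + BT (x - (t 0 + A z₀))) (t m + A z) =
        aT m + BT (t m + A z - (t 0 + A z₀)))
    (hpt : ∀ x ∈ Sites₀ t A, x ≠ t 0 + A z₀ → dist x c₀ ≤ ρ →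
      ‖h x - ((fun x : E3 => (if (∃ z ∈ Λ₀, x = t 1 + A z) then aT 1 else aT 0) + BT (x - (t 0 + A z₀))) x)‖ ≤
        K * (dist x (t 0 + A z₀)) ^ 2)
    (hBT : ‖BT‖ ≤ κ / (2 * 10 ^ 10))
    (hs₂ : 2 / κ * (38 * (1024 / ((23 / 25 : ℝ) ^ 3 * (23 / 25 : ℝ) ^ 4)) * ‖BT‖ +
      38 * (1024 / ((23 / 25 : ℝ) ^ 3 * (23 / 25 : ℝ) ^ 3)) * K +
      38 * (1024 / ((23 / 25 : ℝ) ^ 3 * (ρ - 11 / 10) ^ 5)) * Vₐ +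
      38 * (1024 / ((23 / 25 : ℝ) ^ 3 * (ρ - 11 / 10) ^ 4)) * ‖BT‖ +
      38 * Real.sqrt (1024 / ((23 / 25 : ℝ) ^ 3 * (ρ - 11 / 10) ^ 5)) * Real.sqrt (39 * J)) ≤ κ / (2 * 10 ^ 10))
    (hs₃ : Cˢ * (2 / κ * (38 * (1024 / ((23 / 25 : ℝ) ^ 3 * (23 / 25 : ℝ) ^ 4)) * ‖BT‖ +
      38 * (1024 / ((23 / 25 : ℝ) ^ 3 * (23 / 25 : ℝ) ^ 3)) * K +
      38 * (1024 / ((23 / 25 : ℝ) ^ 3 * (ρ - 11 / 10) ^ 5)) * Vₐ +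
      38 * (1024 / ((23 / 25 : ℝ) ^ 3 * (ρ - 11 / 10) ^ 4)) * ‖BT‖ +
      38 * Real.sqrt (1024 / ((23 / 25 : ℝ) ^ 3 * (ρ - 11 / 10) ^ 5)) * Real.sqrt (39 * J))) + Cᴮ * ‖BT‖ ≤ κ ^ 2 / 10 ^ 11) :
    ∃ ξ : E3,
      ‖aT 0 - aT 1‖ ≤ 2 / κ * (38 * (1024 / ((23 / 25 : ℝ) ^ 3 * (23 / 25 : ℝ) ^ 4)) * ‖BT‖ +
        38 * (1024 / ((23 / 25 : ℝ) ^ 3 * (23 / 25 : ℝ) ^ 3)) * K +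
        38 * (1024 / ((23 / 25 : ℝ) ^ 3 * (ρ - 11 / 10) ^ 5)) * Vₐ +
        38 * (1024 / ((23 / 25 : ℝ) ^ 3 * (ρ - 11 / 10) ^ 4)) * ‖BT‖ +
        38 * Real.sqrt (1024 / ((23 / 25 : ℝ) ^ 3 * (ρ - 11 / 10) ^ 5)) * Real.sqrt (39 * J)) ∧
      ‖ξ‖ ≤ 4 / κ * (Cˢ * ‖aT 0 - aT 1‖ + Cᴮ * ‖BT‖) ∧
      (∀ (m : Fin 2) (z : E3), z ∈ Λ₀ →
        (fun x : E3 => aff x + ((if (∃ z ∈ Λ₀, x = t 1 + A z) then aT 1 else aT 0) + BT (x - (t 0 + A z₀))) +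
          (if (∃ z ∈ Λ₀, x = t 0 + A z) then ξ else 0)) (t m + A z) =
          (![a 0 + aT 0 + BT (c₀ - (t 0 + A z₀)) + ξ, a 1 + aT 1 + BT (c₀ - (t 0 + A z₀))] : Fin 2 → E3) m +
            (Bm + BT) (t m + A z - c₀)) ∧
      (∀ p : Sites₀ t A, 𝐆[fun x : E3 => aff x + ((if (∃ z ∈ Λ₀, x = t 1 + A z) then aT 1 else aT 0) + BT (x - (t 0 + A z₀))) +
          (if (∃ z ∈ Λ₀, x = t 0 + A z) then ξ else 0)] p = 0) := by
  have hρ3 : (3 : ℝ) ≤ ρ := by linarith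
  -- (1) the jump
  have hjump := taylor_jump_le hA hI hκ0 hκ hh hz₀ hp₀c hrow0 aT BT _ hT ha0 hK hρ3 hVa hpt hJ
  have hjump' : ‖aT 0 - aT 1‖ ≤ κ / (2 * 10 ^ 10) := hjump.trans hs₂
  -- (2) the combined affine data
  obtain ⟨ag, hagdef⟩ : ∃ ag : Fin 2 → E3, ag = fun m => a m + aT m + BT (c₀ - (t 0 + A z₀)) := ⟨_, rfl⟩
  have hag : ∀ m, ag m = a m + aT m + BT (c₀ - (t 0 + A z₀)) := fun m => by rw [hagdef]
  have hgt := affine_add_taylor hA hI haff aT BT ag hag (z₀ := z₀)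
  obtain ⟨hB', hs', hGn⟩ := selfForce_add_taylor_le hA hI hκ1 haff hrel hBm ha aT BT ag hag hBT hjump' hgt
  have hGs : ‖𝐆[fun x : E3 => aff x + ((if (∃ z ∈ Λ₀, x = t 1 + A z) then aT 1 else aT 0) + BT (x - (t 0 + A z₀)))]
      (⟨t 0, t0_mem_sites⟩ : Sites₀ t A)‖ ≤ κ ^ 2 / 10 ^ 11 := by
    refine hGn.trans (le_trans ?_ hs₃)
    have hC : 0 ≤ Cˢ := by positivity
    exact add_le_add (mul_le_mul_of_nonneg_left hjump hC) le_rfl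
  -- (3) relaxation
  obtain ⟨ξ, hξ, haff', hrel'⟩ := exists_relaxed_field hA hI hκ0 hκ1 hκ
    (aff := fun x : E3 => aff x + ((if (∃ z ∈ Λ₀, x = t 1 + A z) then aT 1 else aT 0) + BT (x - (t 0 + A z₀))))
    (a := ag) (B := Bm + BT) (x₀ := c₀) hgt hB' hs' hGs
  refine ⟨ξ, hjump, hξ.trans (mul_le_mul_of_nonneg_left hGn (by positivity)), fun m z hz => ?_, hrel'⟩
  rw [haff' m z hz]
  obtain hm | hm := (Fin.exists_fin_two.mp ⟨m, rfl⟩ : m = 0 ∨ m = 1)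
  · rw [hm]; simp only [Matrix.cons_val_zero, hag 0]
  · rw [hm]; simp only [Matrix.cons_val_one, Matrix.cons_val_zero, hag 1]

-- the statement alone carries five copies of the jump-bound expression; elaboration needs ~3·10⁵ heartbeats
set_option maxHeartbeats 400000 in
/-- **The decay step, corrected self-force threshold** (`step_decay` with `hs₃` stated for the actual
optical jump bound, monotone in `‖Bᵀ‖ ≤ 12√Θ₁`).  `Θ₁, Θ₂` are the slope and Taylor coefficients of
`linear_decay` at `r' = 9ρ`; the smallness hypotheses `hs₁, hs₂, hs₃` (slope, jump and self-force below the
relaxation thresholds) are discharged by the caller from the decay profile. [folklore] -/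
theorem step_decay' (hA : Adm₀ A) (hI : Inner₀ t A) (hκ0 : 0 < κ) (hκ1 : κ ≤ 1)
    (hκ : ∀ v : E3 → E3, (Function.support v).Finite → Function.support v ⊆ Sites₀ t A →
      κ * nnForm t A v ≤ ∑' p : Sites₀ t A, ⟪𝕃 v @ p, v p⟫)
    {h : E3 → E3} (hh : (Function.support h).Finite) {ρ : ℝ} (hρ : 64 ≤ ρ)
    (hrows : ∀ p : Sites₀ t A, dist (p : E3) c₀ ≤ 2 * (1280 * (9 * ρ) + 2388) + 4 → 𝕃 h @ p = 0)
    {V J : ℝ} (hV : ∀ x ∈ Sites₀ t A, dist x c₀ ≤ 11 / 5 → ‖h x‖ ≤ V) (hJ : 𝐉[h, ρ] ≤ J)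
    {aff : E3 → E3} {a : Fin 2 → E3} {Bm : E3 →L[ℝ] E3}
    (haff : ∀ (m : Fin 2) (z : E3), z ∈ Λ₀ → aff (t m + A z) = a m + Bm (t m + A z - c₀))
    (hrel : ∀ p : Sites₀ t A, 𝐆[aff] p = 0)
    (hBm : ‖Bm‖ ≤ κ / (2 * 10 ^ 10)) (ha : ‖a 0 - a 1‖ ≤ κ / (2 * 10 ^ 10))
    {Θ₁ Θ₂ : ℝ}
    (hΘ₁ : 64 * 𝐋 ^ 3 / (9 * ρ) ^ 3 * (𝐋 * (𝐌[h, 4 * (1280 * (9 * ρ) + 2388) + 4] / (1280 * (9 * ρ) + 2388) ^ 2 +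
        𝐉[h, 10 * (9 * ρ) + 10])) + 536 * 𝐋 ^ 3 * (9 * ρ) ^ 3 * 𝐉Δ[h, 10 * (9 * ρ) + 10] ≤ Θ₁)
    (hΘ₂ : 64 * 𝐋 ^ 4 / (9 * ρ) ^ 5 * (𝐋 * (𝐌[h, 4 * (1280 * (9 * ρ) + 2388) + 4] / (1280 * (9 * ρ) + 2388) ^ 2 +
        𝐉[h, 10 * (9 * ρ) + 10])) + (64 * 𝐋 ^ 4 / (9 * ρ) ^ 3 + 3216 * 𝐋 ^ 4 * (9 * ρ) ^ 3) * 𝐉Δ[h, 10 * (9 * ρ) + 10] ≤ Θ₂)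
    (hs₁ : 12 * Real.sqrt Θ₁ ≤ κ / (2 * 10 ^ 10))
    (hs₂ : 2 / κ * (38 * (1024 / ((23 / 25 : ℝ) ^ 3 * (23 / 25 : ℝ) ^ 4)) * (12 * Real.sqrt Θ₁) +
      38 * (1024 / ((23 / 25 : ℝ) ^ 3 * (23 / 25 : ℝ) ^ 3)) * (1428 * Real.sqrt Θ₂) +
      38 * (1024 / ((23 / 25 : ℝ) ^ 3 * (ρ - 11 / 10) ^ 5)) * (V + 11 / 10 * (12 * Real.sqrt Θ₁)) +
      38 * (1024 / ((23 / 25 : ℝ) ^ 3 * (ρ - 11 / 10) ^ 4)) * (12 * Real.sqrt Θ₁) +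
      38 * Real.sqrt (1024 / ((23 / 25 : ℝ) ^ 3 * (ρ - 11 / 10) ^ 5)) * Real.sqrt (39 * J)) ≤ κ / (2 * 10 ^ 10))
    (hs₃ : Cˢ * (2 / κ * (38 * (1024 / ((23 / 25 : ℝ) ^ 3 * (23 / 25 : ℝ) ^ 4)) * (12 * Real.sqrt Θ₁) +
      38 * (1024 / ((23 / 25 : ℝ) ^ 3 * (23 / 25 : ℝ) ^ 3)) * (1428 * Real.sqrt Θ₂) +
      38 * (1024 / ((23 / 25 : ℝ) ^ 3 * (ρ - 11 / 10) ^ 5)) * (V + 11 / 10 * (12 * Real.sqrt Θ₁)) +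
      38 * (1024 / ((23 / 25 : ℝ) ^ 3 * (ρ - 11 / 10) ^ 4)) * (12 * Real.sqrt Θ₁) +
      38 * Real.sqrt (1024 / ((23 / 25 : ℝ) ^ 3 * (ρ - 11 / 10) ^ 5)) * Real.sqrt (39 * J))) +
      Cᴮ * (12 * Real.sqrt Θ₁) ≤ κ ^ 2 / 10 ^ 11) (hΘ₂0 : 0 ≤ Θ₂) :
    ∃ (z₀ : E3) (aT : Fin 2 → E3) (BT : E3 →L[ℝ] E3) (ξ : E3), z₀ ∈ Λ₀ ∧ dist (t 0 + A z₀) c₀ ≤ 11 / 10 ∧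
      ‖BT‖ ≤ 12 * Real.sqrt Θ₁ ∧
      ‖aT 0 - aT 1‖ ≤ 2 / κ * (38 * (1024 / ((23 / 25 : ℝ) ^ 3 * (23 / 25 : ℝ) ^ 4)) * ‖BT‖ +
        38 * (1024 / ((23 / 25 : ℝ) ^ 3 * (23 / 25 : ℝ) ^ 3)) * (1428 * Real.sqrt Θ₂) +
        38 * (1024 / ((23 / 25 : ℝ) ^ 3 * (ρ - 11 / 10) ^ 5)) * (V + 11 / 10 * ‖BT‖) +
        38 * (1024 / ((23 / 25 : ℝ) ^ 3 * (ρ - 11 / 10) ^ 4)) * ‖BT‖ +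
        38 * Real.sqrt (1024 / ((23 / 25 : ℝ) ^ 3 * (ρ - 11 / 10) ^ 5)) * Real.sqrt (39 * J)) ∧
      (∀ m, ‖aT m‖ ≤ V + 11 / 10 * ‖BT‖) ∧
      ‖ξ‖ ≤ 4 / κ * (Cˢ * ‖aT 0 - aT 1‖ + Cᴮ * ‖BT‖) ∧
      (∀ (L : ℝ) (N : ℕ), 400 / 189 * (L + 11 / 5) ≤ N → 4 * (N : ℝ) + 11 ≤ 9 * ρ →
        ∀ (m : Fin 2) (z : E3), z ∈ Λ₀ → dist (t m + A z) c₀ ≤ L →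
          ‖h (t m + A z) - (aT m + BT (t m + A z - (t 0 + A z₀)))‖ ^ 2 ≤ 144 * (N : ℝ) ^ 4 * Θ₂) ∧
      (∀ x ∈ Sites₀ t A, x ≠ t 0 + A z₀ → dist x c₀ ≤ ρ →
        ‖h x - ((fun x : E3 => (if (∃ z ∈ Λ₀, x = t 1 + A z) then aT 1 else aT 0) + BT (x - (t 0 + A z₀))) x)‖ ≤
          1428 * Real.sqrt Θ₂ * (dist x (t 0 + A z₀)) ^ 2) ∧
      (∀ (m : Fin 2) (z : E3), z ∈ Λ₀ →
        (fun x : E3 => aff x + ((if (∃ z ∈ Λ₀, x = t 1 + A z) then aT 1 else aT 0) + BT (x - (t 0 + A z₀))) +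
          (if (∃ z ∈ Λ₀, x = t 0 + A z) then ξ else 0)) (t m + A z) =
          (![a 0 + aT 0 + BT (c₀ - (t 0 + A z₀)) + ξ, a 1 + aT 1 + BT (c₀ - (t 0 + A z₀))] : Fin 2 → E3) m +
            (Bm + BT) (t m + A z - c₀)) ∧
      (∀ p : Sites₀ t A, 𝐆[fun x : E3 => aff x + ((if (∃ z ∈ Λ₀, x = t 1 + A z) then aT 1 else aT 0) + BT (x - (t 0 + A z₀))) +
          (if (∃ z ∈ Λ₀, x = t 0 + A z) then ξ else 0)] p = 0) := by
  obtain ⟨z₀, aT, BT, hz₀, hp₀c, hBT, ha0, hval, hT, htay, hpt⟩ :=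
    step_decay_taylor hA hI hκ0 hκ hh hρ hrows hV hΘ₁ hΘ₂ hΘ₂0
  have hBn : 0 ≤ ‖BT‖ := norm_nonneg _
  have hBT' : ‖BT‖ ≤ κ / (2 * 10 ^ 10) := hBT.trans hs₁
  have hρ' : 0 < ρ - 11 / 10 := by linarith
  have hK : 0 ≤ 1428 * Real.sqrt Θ₂ := by positivity
  -- monotonicity of the jump bound in ‖BT‖ ≤ 12√Θ₁
  have hmono : 2 / κ * (38 * (1024 / ((23 / 25 : ℝ) ^ 3 * (23 / 25 : ℝ) ^ 4)) * ‖BT‖ +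
      38 * (1024 / ((23 / 25 : ℝ) ^ 3 * (23 / 25 : ℝ) ^ 3)) * (1428 * Real.sqrt Θ₂) +
      38 * (1024 / ((23 / 25 : ℝ) ^ 3 * (ρ - 11 / 10) ^ 5)) * (V + 11 / 10 * ‖BT‖) +
      38 * (1024 / ((23 / 25 : ℝ) ^ 3 * (ρ - 11 / 10) ^ 4)) * ‖BT‖ +
      38 * Real.sqrt (1024 / ((23 / 25 : ℝ) ^ 3 * (ρ - 11 / 10) ^ 5)) * Real.sqrt (39 * J)) ≤
      2 / κ * (38 * (1024 / ((23 / 25 : ℝ) ^ 3 * (23 / 25 : ℝ) ^ 4)) * (12 * Real.sqrt Θ₁) +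
      38 * (1024 / ((23 / 25 : ℝ) ^ 3 * (23 / 25 : ℝ) ^ 3)) * (1428 * Real.sqrt Θ₂) +
      38 * (1024 / ((23 / 25 : ℝ) ^ 3 * (ρ - 11 / 10) ^ 5)) * (V + 11 / 10 * (12 * Real.sqrt Θ₁)) +
      38 * (1024 / ((23 / 25 : ℝ) ^ 3 * (ρ - 11 / 10) ^ 4)) * (12 * Real.sqrt Θ₁) +
      38 * Real.sqrt (1024 / ((23 / 25 : ℝ) ^ 3 * (ρ - 11 / 10) ^ 5)) * Real.sqrt (39 * J)) := by
    gcongr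
  have hs₂' := hmono.trans hs₂
  have hCs0 : (0 : ℝ) ≤ Cˢ := by positivity
  have hCb0 : (0 : ℝ) ≤ Cᴮ := by positivity
  have hs₃' : Cˢ * (2 / κ * (38 * (1024 / ((23 / 25 : ℝ) ^ 3 * (23 / 25 : ℝ) ^ 4)) * ‖BT‖ +
      38 * (1024 / ((23 / 25 : ℝ) ^ 3 * (23 / 25 : ℝ) ^ 3)) * (1428 * Real.sqrt Θ₂) +
      38 * (1024 / ((23 / 25 : ℝ) ^ 3 * (ρ - 11 / 10) ^ 5)) * (V + 11 / 10 * ‖BT‖) +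
      38 * (1024 / ((23 / 25 : ℝ) ^ 3 * (ρ - 11 / 10) ^ 4)) * ‖BT‖ +
      38 * Real.sqrt (1024 / ((23 / 25 : ℝ) ^ 3 * (ρ - 11 / 10) ^ 5)) * Real.sqrt (39 * J))) + Cᴮ * ‖BT‖ ≤ κ ^ 2 / 10 ^ 11 :=
    (add_le_add (mul_le_mul_of_nonneg_left hmono hCs0) (mul_le_mul_of_nonneg_left hBT hCb0)).trans hs₃
  have hrow0 : 𝕃 h @ (⟨t 0 + A z₀, add_mem_sites₀ t0_mem_sites hz₀⟩ : Sites₀ t A) = 0 :=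
    hrows _ (hp₀c.trans (by linarith))
  obtain ⟨ξ, hjump, hξ, haff', hrel'⟩ := step_decay_relax' hA hI hκ0 hκ1 hκ hh hρ hz₀ hp₀c hrow0 hJ haff hrel hBm ha
    aT BT ha0 hK hval hT hpt hBT' hs₂' hs₃'
  exact ⟨z₀, aT, BT, ξ, hz₀, hp₀c, hBT, hjump, hval, hξ, htay, hpt, haff', hrel'⟩

end

end Summit.AtomisticToContinuum.Crystallization.Theorems.ExcessDecayLiouville

end
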